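import Literature.Topology.FourManifolds.SliceRibbon
import Literature.Topology.FourManifolds.SliceDiscEndCollar
import Literature.Topology.FourManifolds.SliceDiscEndCollarFactsProofs
import Literature.Topology.FourManifolds.SliceDiscConicalFramingExistence
import Literature.Topology.FourManifolds.TubularNbhdConeTube
import Literature.Topology.FourManifolds.ClosedBall
import Mathlib.Analysis.Normed.Module.Ball.Homeomorph
import HarnessLib

/-!
# Smoothly slice knots are topologically slice (discharge of `Knot.IsSmoothlySlice.isTopologicallySlice`)

Sibling proof file of `Literature/Topology/FourManifolds/SliceRibbon.lean`, proving its named fact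
`Literature.Topology.FourManifolds.Knot.IsSmoothlySlice.isTopologicallySlice`: a knot bounding a
smooth (neat) slice disc in `B⁴` (`Knot.IsSmoothlySlice`) bounds a *flat* disc
(`Knot.IsTopologicallySlice`: a map `F : ℝ² × ℝ² → ℝ⁴` which is a topological embedding on
`𝔻² × ℝ²`, maps `𝔻² × ℝ²` into the closed unit ball meeting `𝕊³` exactly along `∂𝔻² × ℝ²`, with core
`F (·, 0)|𝕊¹ = K`). Freedman–Quinn (1990), §9.3; Livingston (2005), §2: "a tubular neighbourhood
of a smooth neat slice disc is a product neighbourhood".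

## Proof

The tubular neighbourhood is supplied by two facts of `SliceDiscEndCollarFacts.lean` that are
**theorems** of the tree:

* `Knot.IsSliceDisc.exists_conical_diffeomorph_holds` (`SliceDiscEndCollarFactsProofs.lean`;
  Kosinski (1993), Ch. II (2.8.2)): the knot bounds a slice disc `g₁` which is the cone
  `g₁ (t • u) = t • K u` on a band `1 - s₁ ≤ t ≤ 1`;
* `Knot.IsSliceDisc.exists_conicalTube_hasFraming_zero_holds`
  (`SliceDiscConicalFramingExistence.lean`; Kosinski (1993), Ch. III (4.2)): such a disc has a
  trivialised tube `G : D̊² × B(0, 2) → B̊⁴`, a `C^∞` injective immersion with `G (x, 0) = g₁ x`,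
  which over the band is the cone `G (t • u, w) = t • ν (u, w)` over a tubular neighbourhood
  `ν : 𝕊¹ × ℝ² ↪ 𝕊³` of `K`.

Both are bundled as a `ConicalDiscTube K` (`SliceDiscEndCollar.lean`). The flat disc is
`F (x, w) = Ḡ (x, β w)`, where `β : ℝ² ≃ₜ B(0, 1)` is Mathlib's `Homeomorph.unitBall` and the
*extended tube* `Ḡ` is `G` on `D̊² × ℝ²` extended over `∂𝔻²` by the cone tube
`(x, w) ↦ ‖x‖ • ν (x / ‖x‖, w)` of `ν` (`Knot.TubularNbhd.coneTube`, `TubularNbhdConeTube.lean`), with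
which `G` agrees on the band. `Ḡ` is continuous and injective on `𝔻² × B(0, 2)` (injectivity of `G`,
of the cone tube, and `‖G‖ < 1 = ‖cone‖` over the boundary), hence a topological embedding of the
compact `𝔻² × B̄(0, 1)`; composing with the embedding `(x, w) ↦ (x, β w)` of `𝔻² × ℝ²` into it gives
the embedding clause; `‖F‖ ≤ 1` with equality exactly over `∂𝔻²`, and `F (u, 0) = ν (u, 0) = K u`.

## References

* M. H. Freedman, F. Quinn, *Topology of 4-manifolds*, Princeton Math. Series 39 (1990), §9.3.
  [FreedmanQuinn1990]
* A. A. Kosinski, *Differential Manifolds* (1993), Ch. II (2.8.2), Ch. III (4.2) (neat tubular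
  neighbourhoods). [Kosinski1993]
* C. Livingston, *A survey of classical knot concordance* (2005), §2. [Livingston2005]

## Design notes

No statement of another file is modified; no definition, no named fact, no `sorry` (theorems only).
The extended tube is not introduced as a definition: the lemmas are stated for any function `E`
satisfying its defining equation `hE` (so that the file is a pure proof file), and the discharge
instantiates `E` with the formula.
-/

open Metric Set Filter Topology Function

noncomputable section

namespace Literature.Topology.FourManifolds

namespace ConicalDiscTube

variable {K : Knot} (D : ConicalDiscTube K)
  {E : EuclideanSpace ℝ (Fin 2) × EuclideanSpace ℝ (Fin 2) → EuclideanSpace ℝ (Fin 4)}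
  (hE : ∀ p, E p = if ‖p.1‖ < 1 then D.G p else D.ν.coneTube p)

/-! ### The extended disc tube

`E` is the disc tube `G` extended over the closed disc by the cone tube of the tube `ν` of the knot:
`E p = if ‖p.1‖ < 1 then G p else ν.coneTube p` (hypothesis `hE`). -/

include hE

/-- Over the open disc the extended tube is `G`. [folklore] -/
theorem extTube_of_norm_lt {p : EuclideanSpace ℝ (Fin 2) × EuclideanSpace ℝ (Fin 2)}
    (h : ‖p.1‖ < 1) : E p = D.G p := by
  rw [hE, if_pos h]

/-- Off the open disc the extended tube is the cone tube. [folklore] -/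
theorem extTube_of_not_norm_lt {p : EuclideanSpace ℝ (Fin 2) × EuclideanSpace ℝ (Fin 2)}
    (h : ¬ ‖p.1‖ < 1) : E p = D.ν.coneTube p := by
  rw [hE, if_neg h]

/-- Over the conical band (and beyond) the extended tube is the cone tube, for fibre coordinates in
`B(0, 2)` (the cone clause of the datum). [folklore] -/
theorem extTube_eq_coneTube {p : EuclideanSpace ℝ (Fin 2) × EuclideanSpace ℝ (Fin 2)}
    (h₁ : 1 - D.s₁ < ‖p.1‖) (hw : ‖p.2‖ < 2) : E p = D.ν.coneTube p := by
  by_cases h : ‖p.1‖ < 1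
  · rw [D.extTube_of_norm_lt hE h]
    exact D.G_eq_smul h₁ h hw
  · exact D.extTube_of_not_norm_lt hE h

/-- The extended tube is continuous on `𝔻² × B(0, 2)`. [folklore] -/
theorem continuousOn_extTube :
    ContinuousOn E (closedBall (0 : EuclideanSpace ℝ (Fin 2)) 1 ×ˢ
      ball (0 : EuclideanSpace ℝ (Fin 2)) 2) := by
  intro p hp
  rw [mem_prod, mem_closedBall_zero_iff, mem_ball_zero_iff] at hp
  by_cases h : ‖p.1‖ < 1
  · -- near `p` the extended tube is `G`
    have hO : {q : EuclideanSpace ℝ (Fin 2) × EuclideanSpace ℝ (Fin 2) | ‖q.1‖ < 1} ∈ 𝓝 p :=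
      (isOpen_lt (continuous_norm.comp continuous_fst) continuous_const).mem_nhds h
    rw [← continuousWithinAt_inter hO]
    have hG : ContinuousOn D.G ((closedBall (0 : EuclideanSpace ℝ (Fin 2)) 1 ×ˢ
        ball (0 : EuclideanSpace ℝ (Fin 2)) 2) ∩ {q | ‖q.1‖ < 1}) :=
      D.contDiffOn.continuousOn.mono fun q hq =>
        mem_prod.2 ⟨mem_ball_zero_iff.2 hq.2, (mem_prod.1 hq.1).2⟩
    refine (hG.congr fun q hq => D.extTube_of_norm_lt hE hq.2).continuousWithinAt ⟨?_, h⟩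
    exact mem_prod.2 ⟨mem_closedBall_zero_iff.2 hp.1, mem_ball_zero_iff.2 hp.2⟩
  · -- near `p` the extended tube is the cone tube
    have hp1 : ‖p.1‖ = 1 := le_antisymm hp.1 (not_lt.1 h)
    have hO : {q : EuclideanSpace ℝ (Fin 2) × EuclideanSpace ℝ (Fin 2) | 1 - D.s₁ < ‖q.1‖} ∈ 𝓝 p :=
      (isOpen_lt continuous_const (continuous_norm.comp continuous_fst)).mem_nhds
        (by change 1 - D.s₁ < ‖p.1‖; rw [hp1]; linarith [D.s₁_pos])
    rw [← continuousWithinAt_inter hO]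
    have hC : ContinuousOn D.ν.coneTube ((closedBall (0 : EuclideanSpace ℝ (Fin 2)) 1 ×ˢ
        ball (0 : EuclideanSpace ℝ (Fin 2)) 2) ∩ {q | 1 - D.s₁ < ‖q.1‖}) :=
      D.ν.continuousOn_coneTube.mono fun q hq => by
        have : 0 < ‖q.1‖ := lt_trans (by linarith [D.s₁_lt]) hq.2
        exact norm_pos_iff.1 this
    refine (hC.congr fun q hq => D.extTube_eq_coneTube hE hq.2 ?_).continuousWithinAt ⟨?_, ?_⟩
    · exact mem_ball_zero_iff.1 (mem_prod.1 hq.1).2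
    · exact mem_prod.2 ⟨mem_closedBall_zero_iff.2 hp.1, mem_ball_zero_iff.2 hp.2⟩
    · change 1 - D.s₁ < ‖p.1‖
      rw [hp1]
      linarith [D.s₁_pos]

/-- Over the open disc the extended tube stays in the open ball. [folklore] -/
theorem norm_extTube_lt {p : EuclideanSpace ℝ (Fin 2) × EuclideanSpace ℝ (Fin 2)}
    (h : ‖p.1‖ < 1) (hw : ‖p.2‖ < 2) : ‖E p‖ < 1 := by
  rw [D.extTube_of_norm_lt hE h]
  exact mem_ball_zero_iff.1
    (D.maps_ball p (mem_prod.2 ⟨mem_ball_zero_iff.2 h, mem_ball_zero_iff.2 hw⟩))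

/-- Over the boundary circle the extended tube lies on the sphere. [folklore] -/
theorem norm_extTube_eq {p : EuclideanSpace ℝ (Fin 2) × EuclideanSpace ℝ (Fin 2)}
    (h : ‖p.1‖ = 1) : ‖E p‖ = 1 := by
  rw [D.extTube_of_not_norm_lt hE (by rw [h]; exact lt_irrefl 1),
    Knot.TubularNbhd.norm_coneTube, h]

/-- The extended tube is injective on `𝔻² × B(0, 2)`: `G` is injective on the open part, the cone
tube on the boundary part, and the two parts have different norms. [folklore] -/
theorem injOn_extTube :
    InjOn E (closedBall (0 : EuclideanSpace ℝ (Fin 2)) 1 ×ˢ ball (0 : EuclideanSpace ℝ (Fin 2)) 2) := by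
  intro p hp p' hp' hpp
  rw [mem_prod, mem_closedBall_zero_iff, mem_ball_zero_iff] at hp hp'
  by_cases hx : ‖p.1‖ < 1 <;> by_cases hx' : ‖p'.1‖ < 1
  · -- both in the open part
    rw [D.extTube_of_norm_lt hE hx, D.extTube_of_norm_lt hE hx'] at hpp
    exact D.injOn (mem_prod.2 ⟨mem_ball_zero_iff.2 hx, mem_ball_zero_iff.2 hp.2⟩)
      (mem_prod.2 ⟨mem_ball_zero_iff.2 hx', mem_ball_zero_iff.2 hp'.2⟩) hpp
  · -- different norms
    have h1 : ‖p'.1‖ = 1 := le_antisymm hp'.1 (not_lt.1 hx')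
    have hlt := D.norm_extTube_lt hE hx hp.2
    rw [hpp, D.norm_extTube_eq hE h1] at hlt
    exact absurd hlt (lt_irrefl 1)
  · have h1 : ‖p.1‖ = 1 := le_antisymm hp.1 (not_lt.1 hx)
    have hlt := D.norm_extTube_lt hE hx' hp'.2
    rw [← hpp, D.norm_extTube_eq hE h1] at hlt
    exact absurd hlt (lt_irrefl 1)
  · -- both on the boundary: the cone tube is injective off `x = 0`
    have h1 : ‖p.1‖ = 1 := le_antisymm hp.1 (not_lt.1 hx)
    have h1' : ‖p'.1‖ = 1 := le_antisymm hp'.1 (not_lt.1 hx')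
    rw [D.extTube_of_not_norm_lt hE hx, D.extTube_of_not_norm_lt hE hx'] at hpp
    refine D.ν.injOn_coneTube ?_ ?_ hpp
    · exact norm_pos_iff.1 (by rw [h1]; exact one_pos)
    · exact norm_pos_iff.1 (by rw [h1']; exact one_pos)

/-- The core of the extended tube over the boundary circle is the knot. [folklore] -/
theorem extTube_coe_zero (u : Metric.sphere (0 : EuclideanSpace ℝ (Fin 2)) 1) :
    E ((u : EuclideanSpace ℝ (Fin 2)), 0) = K u := by
  have hu : ‖(u : EuclideanSpace ℝ (Fin 2))‖ = 1 := norm_eq_of_mem_sphere u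
  have h : ¬ ‖((u : EuclideanSpace ℝ (Fin 2)), (0 : EuclideanSpace ℝ (Fin 2))).1‖ < 1 := by
    rw [hu]; exact lt_irrefl 1
  rw [D.extTube_of_not_norm_lt hE h, D.ν.coneTube_coe, D.ν.coe_apply_zero]

/-! ### The flat disc `(x, w) ↦ E (x, β w)` -/

omit hE in
/-- The fibre reparametrisation `β = Homeomorph.unitBall` lands in the open unit ball. [folklore] -/
theorem norm_unitBall_lt (w : EuclideanSpace ℝ (Fin 2)) :
    ‖((Homeomorph.unitBall w : ball (0 : EuclideanSpace ℝ (Fin 2)) 1) : EuclideanSpace ℝ (Fin 2))‖ < 1 :=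
  mem_ball_zero_iff.1 (Homeomorph.unitBall w).2

/-- **The flat disc is a topological embedding on `𝔻² × ℝ²`.** The extended tube is a continuous
injection of the compact `𝔻² × B̄(0, 1)` into `ℝ⁴`, hence an embedding, and `(x, w) ↦ (x, β w)`
embeds `𝔻² × ℝ²` into it. [folklore] -/
theorem isEmbedding_restrict_flatDisc :
    Topology.IsEmbedding ((closedBall (0 : EuclideanSpace ℝ (Fin 2)) 1 ×ˢ
      (univ : Set (EuclideanSpace ℝ (Fin 2)))).restrict
        fun p => E (p.1, ((Homeomorph.unitBall p.2 : ball (0 : EuclideanSpace ℝ (Fin 2)) 1) :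
          EuclideanSpace ℝ (Fin 2)))) := by
  -- the compact piece `C = 𝔻² × B̄(0, 1)` of the domain of the extended tube
  set C : Set (EuclideanSpace ℝ (Fin 2) × EuclideanSpace ℝ (Fin 2)) :=
    closedBall (0 : EuclideanSpace ℝ (Fin 2)) 1 ×ˢ closedBall (0 : EuclideanSpace ℝ (Fin 2)) 1 with hC
  have hCsub : C ⊆ closedBall (0 : EuclideanSpace ℝ (Fin 2)) 1 ×ˢ
      ball (0 : EuclideanSpace ℝ (Fin 2)) 2 :=
    prod_mono Subset.rfl (closedBall_subset_ball (by norm_num))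
  haveI : CompactSpace C :=
    isCompact_iff_compactSpace.1 ((isCompact_closedBall _ _).prod (isCompact_closedBall _ _))
  have hΦ : Topology.IsEmbedding (C.restrict E) :=
    (Continuous.isClosedEmbedding
      (continuousOn_iff_continuous_restrict.1 ((D.continuousOn_extTube hE).mono hCsub))
      (injOn_iff_injective.1 ((D.injOn_extTube hE).mono hCsub))).isEmbedding
  -- the embedding `(x, w) ↦ (x, β w)` of `𝔻² × ℝ²` into `C`
  set ψ : EuclideanSpace ℝ (Fin 2) × EuclideanSpace ℝ (Fin 2) →
      EuclideanSpace ℝ (Fin 2) × EuclideanSpace ℝ (Fin 2) :=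
    Prod.map id (fun w => ((Homeomorph.unitBall w : ball (0 : EuclideanSpace ℝ (Fin 2)) 1) :
      EuclideanSpace ℝ (Fin 2))) with hψ
  have hψe : Topology.IsEmbedding ψ :=
    Topology.IsEmbedding.id.prodMap
      (Topology.IsEmbedding.subtypeVal.comp
        (Homeomorph.unitBall (E := EuclideanSpace ℝ (Fin 2))).isEmbedding)
  have hmem : ∀ p : ↥(closedBall (0 : EuclideanSpace ℝ (Fin 2)) 1 ×ˢ
      (univ : Set (EuclideanSpace ℝ (Fin 2)))),
      ψ (p : EuclideanSpace ℝ (Fin 2) × EuclideanSpace ℝ (Fin 2)) ∈ C := fun p =>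
    mem_prod.2 ⟨(mem_prod.1 p.2).1, mem_closedBall_zero_iff.2 (norm_unitBall_lt _).le⟩
  have hι : Topology.IsEmbedding (codRestrict (ψ ∘ ((↑) : ↥(closedBall
      (0 : EuclideanSpace ℝ (Fin 2)) 1 ×ˢ (univ : Set (EuclideanSpace ℝ (Fin 2)))) →
        EuclideanSpace ℝ (Fin 2) × EuclideanSpace ℝ (Fin 2))) C hmem) :=
    (hψe.comp Topology.IsEmbedding.subtypeVal).codRestrict C hmem
  exact hΦ.comp hι

/-- The flat disc maps `𝔻² × ℝ²` into the closed ball, meeting the sphere exactly over `∂𝔻²`.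
[folklore] -/
theorem norm_flatDisc (x w : EuclideanSpace ℝ (Fin 2)) (hx : ‖x‖ ≤ 1) :
    ‖E (x, ((Homeomorph.unitBall w : ball (0 : EuclideanSpace ℝ (Fin 2)) 1) :
      EuclideanSpace ℝ (Fin 2)))‖ ≤ 1 ∧
    (‖E (x, ((Homeomorph.unitBall w : ball (0 : EuclideanSpace ℝ (Fin 2)) 1) :
      EuclideanSpace ℝ (Fin 2)))‖ = 1 ↔ ‖x‖ = 1) := by
  rcases hx.lt_or_eq with h | h
  · have hlt := D.norm_extTube_lt hE (p := (x, ((Homeomorph.unitBall w :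
      ball (0 : EuclideanSpace ℝ (Fin 2)) 1) : EuclideanSpace ℝ (Fin 2)))) h
      ((norm_unitBall_lt w).trans one_lt_two)
    exact ⟨hlt.le, ⟨fun h1 => absurd h1 hlt.ne, fun h1 => absurd h1 h.ne⟩⟩
  · have heq := D.norm_extTube_eq hE (p := (x, ((Homeomorph.unitBall w :
      ball (0 : EuclideanSpace ℝ (Fin 2)) 1) : EuclideanSpace ℝ (Fin 2)))) h
    exact ⟨heq.le, ⟨fun _ => h, fun _ => heq⟩⟩

/-- **A knot with a conical slice disc and framed conical tube is topologically slice**: the flat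
disc is `(x, w) ↦ E (x, β w)`. [folklore] -/
theorem isTopologicallySlice_of_extTube : K.IsTopologicallySlice := by
  refine ⟨fun p => E (p.1, ((Homeomorph.unitBall p.2 : ball (0 : EuclideanSpace ℝ (Fin 2)) 1) :
    EuclideanSpace ℝ (Fin 2))), D.isEmbedding_restrict_flatDisc hE, D.norm_flatDisc hE, fun u => ?_⟩
  simp only [Homeomorph.coe_unitBall_apply_zero]
  exact D.extTube_coe_zero hE u

omit hE in
/-- **A knot with a conical slice disc and framed conical tube is topologically slice.** [folklore] -/
theorem isTopologicallySlice (D : ConicalDiscTube K) : K.IsTopologicallySlice :=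
  D.isTopologicallySlice_of_extTube (E := fun p => if ‖p.1‖ < 1 then D.G p else D.ν.coneTube p)
    fun _ => rfl

end ConicalDiscTube

/-! ### Discharge of the named fact -/

/-- **Smoothly slice knots are topologically slice** — discharge of the named fact
`Knot.IsSmoothlySlice.isTopologicallySlice` (`SliceRibbon.lean`; Freedman–Quinn (1990), §9.3;
Livingston (2005), §2). A smooth slice disc is straightened to a conical one
(`Knot.IsSliceDisc.exists_conical_diffeomorph_holds`, Kosinski (1993), Ch. II (2.8.2)), which has
a framed conical tube (`Knot.IsSliceDisc.exists_conicalTube_hasFraming_zero_holds`, Kosinski (1993),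
Ch. III (4.2)); the tube, extended over the boundary circle by the cone over the tube of the knot
and reparametrised in the fibre by `ℝ² ≃ₜ B(0, 1)`, is the flat disc
(`ConicalDiscTube.isTopologicallySlice`). [cite: FreedmanQuinn1990, §9.3]
[cite: Kosinski1993, Ch. III Thm (4.2)] -/
theorem Knot.IsSmoothlySlice.isTopologicallySlice_holds :
    Knot.IsSmoothlySlice.isTopologicallySlice := by
  intro K hK
  obtain ⟨g, hg⟩ := hK
  obtain ⟨g₁, s₁, Θ, hg₁, hs₁, hs₁1, hcone, -⟩ :=
    Knot.IsSliceDisc.exists_conical_diffeomorph_holds K g hg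
  obtain ⟨ν, hν0, s₀, G, hs₀, hs₀1, hcd, hinj, hfd, hball, hzero, hconeG, hdeep⟩ :=
    Knot.IsSliceDisc.exists_conicalTube_hasFraming_zero_holds K g₁ s₁ hg₁ hs₁ hs₁1 hcone
  let D : ConicalDiscTube K :=
    { g := g₁, s₁ := s₁, s₀ := s₀, ν := ν, G := G, isSliceDisc := hg₁, s₀_pos := hs₀,
      s₀_lt := hs₀1, s₁_lt := hs₁1, hasFraming := hν0, g_cone := hcone, contDiffOn := hcd,
      injOn := hinj, injective_fderiv := hfd, maps_ball := hball, apply_zero := hzero,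
      cone := hconeG, deep := hdeep }
  exact D.isTopologicallySlice

end Literature.Topology.FourManifolds
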